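import Literature.Geometry.Kaehler.TangentConeChain
import Literature.Geometry.GeometricMeasureTheory.ContentCover
import Literature.Geometry.GeometricMeasureTheory.CurrentsSlicing
import Mathlib.Geometry.Manifold.PartitionOfUnity
import HarnessLib

/-!
# Weak convergence of the blow-ups of a holomorphic chain to its tangent cone

Let `T` be a holomorphic `p`-chain (`p = q + 1`) with support of pure dimension `p` on an open
subset `Ω` of a finite-dimensional complex inner product space `V`, `b ∈ Ω`,
`D_r = (1/r)_*(τ_{-b})_*[T]` its blow-ups on the unit ball `𝐁(0,1)` and `C(T,b)` the tangent-cone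
chain (`TangentConeChain.lean`). This file proves **King's theorem in the weak topology on the
whole unit ball**:

`D_r(ψ) → [C(T,b)](ψ)` as `r → 0⁺`, for every test form `ψ ∈ 𝓓^{2p}(𝐁(0,1))`
(`HolomorphicChain.tendsto_blowUp_apply`),

following the architecture of [Federer1969, 4.3.16–4.3.18] / [Harvey1977, Thm. 1.31]: the unit
ball splits into three kinds of directions —

* (Z) directions off the limit cone `F = limitCone |T| hb`: there the blown-up supports are
  eventually absent (`HolomorphicChain.eventually_forall_mem_of_blowUp`), so `D_r(ψ) = 0`
  eventually and `[C(T,b)](ψ) = 0` (`exists_nhds_forall_blowUp_apply_eq_zero`,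
  `toCurrent_tangentConeChain_apply_eq_zero`);
* (M) the regular directions `M` of `F` of dimension `p`: there `D_r(ψ) → [C(T,b)](ψ)` locally
  (`HolomorphicChain.tendsto_blowUp_apply_tangentConeChain`, the collapse of the chart windows);
* (B) the bad directions `F ∖ M`, a closed `𝓗^{2p}`-null set
  (`euclideanHausdorffMeasure_image_limitConeBad_eq_zero`): by the uniform density bounds for the
  blow-ups and for `C(T,b)` (`exists_lintegral_blowUpDensity_ball_le'`,
  `exists_lintegral_density_ball_le'`) and a finite ball cover of small `2p`-content
  (`exists_finset_ball_cover_of_hausdorffMeasure_lt`), the bad directions inside `𝐁̄(0,ρ')` have an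
  open neighbourhood `U` on which `|D_r(ψ)|, |[C(T,b)](ψ)| ≤ γ · sup ‖ψ‖` for all small `r`
  (`exists_open_limitConeBad_subset`);

and a smooth partition of unity subordinate to finitely many such neighbourhoods covering
`spt ψ` assembles the three estimates. An unconditional form (no pure-dimensionality hypothesis,
with SOME conic holomorphic chain as the limit) is `HolomorphicChain.exists_conic_tendsto_blowUp_apply`.

What remains of `Literature.Geometry.Kaehler.King1971_tangentCone` after this file: the upgrade from
weak to locally FLAT convergence (`D_r − [C] = R + ∂S` with `𝐌(R) + 𝐌(S)` small on `W ⋐ 𝐁(0,1)`).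

Theorems only; no new definitions, no named facts.

## References

* H. Federer, *Geometric Measure Theory*, Springer 1969, 2.10.2, 4.1.7, 4.3.16–4.3.19
  [Federer1969].
* R. Harvey, *Holomorphic chains and their boundaries*, PSPUM XXX.1 (1977), §1.10, Thm. 1.31
  [Harvey1977].
* J. R. King, *The currents defined by analytic varieties*, Acta Math. 127 (1971), §5.
* E. M. Chirka, *Complex Analytic Sets*, Kluwer 1989, §8.1, §14.1 [Chirka1989].
-/

noncomputable section

open scoped Manifold Topology ENNReal NNReal InnerProductSpace ContDiff Distributions
open Set Filter MeasureTheory Metric Function Module TopologicalSpace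

namespace Literature.Geometry.Kaehler

open Literature.Geometry.GeometricMeasureTheory

-- Nested operator-norm instances on (duals of) `V [⋀^Fin n]→L[ℝ] ℝ`.
set_option maxSynthPendingDepth 2

universe u

variable {V : Type u} [NormedAddCommGroup V] [InnerProductSpace ℂ V] [FiniteDimensional ℂ V]

/-! ### Plumbing -/

section Plumbing

/-- Finite subadditivity of the lower integral over a finite union. [folklore] -/
private theorem lintegral_biUnion_finset_le {α : Type*} [MeasurableSpace α] (μ : Measure α)
    {ι : Type*} (S : Finset ι) (A : ι → Set α) (f : α → ℝ≥0∞) :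
    ∫⁻ x in ⋃ n ∈ S, A n, f x ∂μ ≤ ∑ n ∈ S, ∫⁻ x in A n, f x ∂μ := by
  classical
  induction S using Finset.induction_on with
  | empty => simp
  | insert a s ha ih =>
    rw [Finset.set_biUnion_insert, Finset.sum_insert ha]
    exact (lintegral_union_le _ _ _).trans (add_le_add le_rfl ih)

/-- Evaluation of a finite sum of test forms. [folklore] -/
private theorem testForm_sum_apply {E : Type*} [NormedAddCommGroup E] [NormedSpace ℝ E]
    {Ω : Opens E} {m : ℕ} {ι : Type*} (s : Finset ι) (φ : ι → TestForm Ω m) (x : E) :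
    (∑ i ∈ s, φ i) x = ∑ i ∈ s, φ i x := by
  classical
  induction s using Finset.induction_on with
  | empty => simp
  | insert a s ha ih => rw [Finset.sum_insert ha, Finset.sum_insert ha, ← ih]; rfl

/-- `μHE[d]`-null sets are `μH[d]`-null. [folklore] -/
private theorem hausdorffMeasure_null_of_euclideanHausdorffMeasure_null {X : Type*}
    [NormedAddCommGroup X] [InnerProductSpace ℝ X] [FiniteDimensional ℝ X] [MeasurableSpace X]
    [BorelSpace X] {d : ℕ} {s : Set X} (h : (μHE[d] : Measure X) s = 0) :
    (μH[(d : ℝ)] : Measure X) s = 0 := by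
  rw [Measure.euclideanHausdorffMeasure_def, Measure.smul_apply, smul_eq_zero] at h
  exact h.resolve_left (Measure.addHaarScalarFactor_volume_hausdorffMeasure_ne_zero _)

/-- `ofReal ρ ^ (m : ℝ) = ofReal (ρ ^ m)` for `ρ ≥ 0`. [folklore] -/
private theorem ofReal_rpow_natCast_eq {ρ : ℝ} (hρ : 0 ≤ ρ) (m : ℕ) :
    ENNReal.ofReal ρ ^ ((m : ℕ) : ℝ) = ENNReal.ofReal (ρ ^ m) := by
  rw [ENNReal.rpow_natCast, ENNReal.ofReal_pow hρ]

end Plumbing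

namespace HolomorphicChain

variable [MeasurableSpace V] [BorelSpace V] {Ω : Opens V}

/-! ### (Z) Away from the limit cone -/

/-- **Off the limit cone the blow-ups vanish eventually**: a point `x` of the open unit ball off
`F = limitCone |T| hb` has a neighbourhood `U ⊆ 𝐁(0,1)` disjoint from `F` such that, for all small
`r > 0`, `D_r(ψ) = 0` for every test form `ψ` supported in `U` (the blown-up supports
`(|T| − b)/r ∩ 𝐁̄(0,1)` eventually miss `Ū`, `eventually_forall_mem_of_blowUp`).
[cite: Federer1969, 4.3.16–4.3.18; Chirka1989, §8.1 Prop. 1] -/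
theorem exists_nhds_forall_blowUp_apply_eq_zero {p : ℕ} (T : HolomorphicChain 𝓘(ℂ, V) Ω p) {b : V}
    (hb : b ∈ (Ω : Set V)) {x : V} (hxF : x ∉ limitCone T.support hb) (hx1 : ‖x‖ < 1) :
    ∃ U : Set V, IsOpen U ∧ x ∈ U ∧ U ⊆ ball (0 : V) 1 ∧ Disjoint U (limitCone T.support hb) ∧
      ∀ᶠ r in 𝓝[>] (0 : ℝ), ∀ ψ : TestForm (unitBall V) (2 * p), tsupport ⇑ψ ⊆ U →
        T.blowUp b r ψ = 0 := by
  letI : InnerProductSpace ℝ V := InnerProductSpace.complexToReal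
  have hFc : IsClosed (limitCone T.support hb) := isClosed_limitCone _ _
  obtain ⟨ε, hε, hεF⟩ := Metric.isOpen_iff.1 hFc.isOpen_compl x hxF
  set δ : ℝ := min (ε / 2) ((1 - ‖x‖) / 2) with hδ
  have hδ0 : 0 < δ := lt_min (half_pos hε) (by linarith)
  have hδε : δ < ε := (min_le_left _ _).trans_lt (half_lt_self hε)
  have hδ1 : ‖x‖ + δ < 1 := by
    have := min_le_right (ε / 2) ((1 - ‖x‖) / 2)
    linarith
  set ρ₀ : ℝ := ‖x‖ + δ with hρ₀
  have hUρ₀ : ball x δ ⊆ closedBall (0 : V) ρ₀ := fun y hy => by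
    rw [mem_closedBall_zero_iff]
    have h1 : ‖y‖ ≤ ‖x‖ + dist y x := by
      have := norm_le_norm_add_norm_sub' y x
      rwa [← dist_eq_norm] at this
    linarith [mem_ball.1 hy]
  have hU1 : ball x δ ⊆ ball (0 : V) 1 := hUρ₀.trans (closedBall_subset_ball hδ1)
  have hUF : Disjoint (ball x δ) (limitCone T.support hb) :=
    disjoint_left.2 fun y hy hyF => hεF (ball_subset_ball hδε.le hy) hyF
  -- the blown-up supports eventually miss the closed ball `𝐁̄(x, δ)`
  have hev := T.eventually_forall_mem_of_blowUp hb (U := (closedBall x δ)ᶜ)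
    isClosed_closedBall.isOpen_compl fun y hy hyc =>
      hεF (closedBall_subset_ball hδε hyc) hy.1
  -- small radii with `B(b, r) ⊆ Ω`
  obtain ⟨R, hR, hRΩ⟩ := Metric.isOpen_iff.1 Ω.isOpen b hb
  refine ⟨ball x δ, isOpen_ball, mem_ball_self hδ0, hU1, hUF, ?_⟩
  filter_upwards [hev, Ioo_mem_nhdsGT hR] with r hr hrR ψ hψ
  have hballr : ball b r ⊆ (Ω : Set V) := (ball_subset_ball hrR.2.le).trans hRΩ
  rw [T.blowUp_apply_eq_blowUpPiece hrR.1 hballr measurableSet_ball hδ1 hUρ₀ ψ hψ]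
  have hempty : T.blowUpSet b r ∩ ball x δ = ∅ := by
    refine eq_empty_iff_forall_notMem.2 fun y hy => ?_
    have hy1 : y ∈ closedBall (0 : V) 1 := ball_subset_closedBall (hU1 hy.2)
    have hmem : b + r • y ∈ ((↑) : Ω → V) '' T.support := T.carrier_subset_image_support hy.1
    exact hr y hy1 hmem (ball_subset_closedBall hy.2)
  rw [blowUpPiece, hempty, currentOfIntegration_empty]
  rfl

/-- **The tangent-cone chain does not see test forms supported off the limit cone**: its current
is carried by `cl(carrier) ⊆ F`. [cite: Harvey1977, Thm. 1.31; Federer1969, 4.3.19] -/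
theorem toCurrent_tangentConeChain_apply_eq_zero {q : ℕ} (T : HolomorphicChain 𝓘(ℂ, V) Ω (q + 1))
    (hA : HasPureDim 𝓘(ℂ, V) T.support (q + 1)) {b : V} (hb : b ∈ (Ω : Set V)) {U : Set V}
    (hU : Disjoint U (limitCone T.support hb)) (ψ : TestForm (⊤ : Opens V) (2 * (q + 1)))
    (hψ : tsupport ⇑ψ ⊆ U) : (tangentConeChain T hA hb).toCurrent ψ = 0 := by
  letI : InnerProductSpace ℝ V := InnerProductSpace.complexToReal
  refine Current.apply_eq_zero_of_disjoint_support _ ((hU.mono_left hψ).mono_right ?_)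
  rw [toCurrent_def]
  refine (support_currentOfIntegration_subset_closure _ _ _).trans ?_
  refine (isClosed_limitCone T.support hb).closure_subset_iff.2 ?_
  refine (carrier_subset_image_support _).trans ?_
  rintro _ ⟨x, hx, rfl⟩
  exact mem_limitConeTop.1 (support_tangentConeChain_subset T hA hb hx)

/-! ### (B) Near the bad directions -/

/-- **The bad directions carry no mass in the limit.** For `0 ≤ ρ' < 1` and `γ > 0` there is an
open set `U ⊇ (F ∖ M) ∩ 𝐁̄(0,ρ')` such that, for all small `r > 0`, `|D_r(ψ)| ≤ γ · sup ‖ψ‖` for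
every test form `ψ` on the unit ball supported in `U`, and `|[C(T,b)](ψ)| ≤ γ · sup ‖ψ‖` for every
test form `ψ` on `V` supported in `U`: cover the compact `𝓗^{2p}`-null set `(F ∖ M) ∩ 𝐁̄(0,ρ')` by
finitely many balls `𝐁(zₙ, sₙ)` centred on it with `Σ sₙ^{2p}` small [Federer1969, 2.10.2] and use
the uniform density bounds `‖D_r‖(𝐁(y,s)), ‖[C]‖(𝐁(y,s)) ≤ Const · s^{2p}` (Lelong).
[cite: Federer1969, 4.3.16–4.3.18; Harvey1977, §1.10, Thm. 1.31] -/
theorem exists_open_limitConeBad_subset {q : ℕ} (T : HolomorphicChain 𝓘(ℂ, V) Ω (q + 1))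
    (hA : HasPureDim 𝓘(ℂ, V) T.support (q + 1)) {b : V} (hb : b ∈ (Ω : Set V)) {ρ' : ℝ}
    (hρ'0 : 0 ≤ ρ') (hρ'1 : ρ' < 1) {γ : ℝ} (hγ : 0 < γ) :
    ∃ U : Set V, IsOpen U ∧
      ((↑) : (⊤ : Opens V) → V) '' limitConeBad T.support hb (q + 1) ∩ closedBall (0 : V) ρ' ⊆ U ∧
      (∀ᶠ r in 𝓝[>] (0 : ℝ), ∀ ψ : TestForm (unitBall V) (2 * (q + 1)), tsupport ⇑ψ ⊆ U →
        ∀ M : ℝ, 0 < M → (∀ x, ‖ψ x‖ ≤ M) → |T.blowUp b r ψ| ≤ γ * M) ∧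
      (∀ ψ : TestForm (⊤ : Opens V) (2 * (q + 1)), tsupport ⇑ψ ⊆ U →
        ∀ M : ℝ, 0 < M → (∀ x, ‖ψ x‖ ≤ M) → |(tangentConeChain T hA hb).toCurrent ψ| ≤ γ * M) := by
  classical
  letI : InnerProductSpace ℝ V := InnerProductSpace.complexToReal
  haveI : FiniteDimensional ℝ V := FiniteDimensional.complexToReal V
  haveI : Nonempty V := ⟨0⟩
  set C := tangentConeChain T hA hb with hCdef
  -- uniform density bounds for the blow-ups and for the tangent-cone chain
  obtain ⟨R, hR, hRΩ⟩ := Metric.isOpen_iff.1 Ω.isOpen b hb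
  set R₁ : ℝ := R / 3 with hR₁
  have hR₁0 : 0 < R₁ := by positivity
  have hball3 : ball b (3 * R₁) ⊆ (Ω : Set V) := by
    rw [hR₁, show 3 * (R / 3) = R by ring]; exact hRΩ
  obtain ⟨Cd, hCdtop, hCd⟩ := T.exists_lintegral_blowUpDensity_ball_le' hR₁0 hball3
  obtain ⟨Cc, hCctop, hCc⟩ := C.exists_lintegral_density_ball_le' (b := (0 : V)) (R₁ := 1) one_pos
    (by simp)
  -- the compact null set of bad directions
  set K : Set V := ((↑) : (⊤ : Opens V) → V) '' limitConeBad T.support hb (q + 1) ∩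
    closedBall (0 : V) ρ' with hK
  have hKc : IsCompact K := (isCompact_closedBall (0 : V) ρ').inter_left isClosed_image_limitConeBad
  have hKρ' : K ⊆ closedBall (0 : V) ρ' := inter_subset_right
  set d : ℝ := ((2 * (q + 1) : ℕ) : ℝ) with hd
  have hd0 : 0 < d := by rw [hd]; positivity
  have hKnull : (μH[d] : Measure V) K = 0 := by
    rw [hd]
    exact hausdorffMeasure_null_of_euclideanHausdorffMeasure_null (measure_mono_null
      inter_subset_left (euclideanHausdorffMeasure_image_limitConeBad_eq_zero (hb := hb) hA))
  -- the smallness parameter of the cover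
  set Kr : ℝ := Cd.toReal + Cc.toReal with hKr
  have hKr0 : 0 ≤ Kr := by rw [hKr]; positivity
  set B₁ : ℝ := 2 ^ (2 * (q + 1)) * (2 ^ (2 * (q + 1) + 1) * 2) with hB₁
  have hB₁0 : 0 < B₁ := by rw [hB₁]; positivity
  set B₀ : ℝ≥0∞ := 2 ^ (2 * (q + 1)) * (2 ^ (2 * (q + 1) + 1) * 2) with hB₀
  have hB₀top : B₀ ≠ ⊤ := by
    rw [hB₀]
    exact ENNReal.mul_ne_top (ENNReal.pow_ne_top (by norm_num))
      (ENNReal.mul_ne_top (ENNReal.pow_ne_top (by norm_num)) (by norm_num))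
  have hB₀real : B₀.toReal = B₁ := by
    rw [hB₀, hB₁, ENNReal.toReal_mul, ENNReal.toReal_mul, ENNReal.toReal_pow, ENNReal.toReal_pow]
    norm_num
  set t : ℝ := γ / ((Kr + 1) * B₁) with ht
  have ht0 : 0 < t := by rw [ht]; positivity
  set γ' : ℝ≥0∞ := ENNReal.ofReal t with hγ'
  have hγ'0 : 0 < γ' := by rw [hγ']; exact ENNReal.ofReal_pos.2 ht0
  have hγ'top : γ' ≠ ⊤ := ENNReal.ofReal_ne_top
  -- `(A · B₀ · γ').toReal ≤ γ` for `A ≤ Cd + Cc`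
  have hkey : ∀ A : ℝ≥0∞, A ≠ ⊤ → A.toReal ≤ Kr → (A * (B₀ * γ')).toReal ≤ γ := by
    intro A hAtop hAle
    rw [ENNReal.toReal_mul, ENNReal.toReal_mul, hB₀real, hγ', ENNReal.toReal_ofReal ht0.le, ht]
    have hKr1 : 0 < Kr + 1 := by linarith
    calc A.toReal * (B₁ * (γ / ((Kr + 1) * B₁))) = A.toReal / (Kr + 1) * γ := by
          field_simp
      _ ≤ 1 * γ := by
          gcongr
          rw [div_le_one hKr1]
          linarith
      _ = γ := one_mul γ
  -- the cover
  set s₀ : ℝ := (1 - ρ') / 4 with hs₀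
  have hs₀0 : 0 < s₀ := by rw [hs₀]; linarith
  obtain ⟨S, xc, ρc, hρc, hKcov, hsum⟩ := exists_finset_ball_cover_of_hausdorffMeasure_lt hd0 hKc
    (γ := γ') (by rw [hKnull]; exact hγ'0) hγ'top hs₀0
  set S' : Finset ℕ := S.filter fun n => (ball (xc n) (ρc n) ∩ K).Nonempty with hS'
  have hS'S : S' ⊆ S := Finset.filter_subset _ _
  -- recentre the useful balls on `K`
  set z : ℕ → V := fun n => if h : (ball (xc n) (ρc n) ∩ K).Nonempty then h.some else 0 with hz
  have hzmem : ∀ n ∈ S', z n ∈ ball (xc n) (ρc n) ∩ K := by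
    intro n hn
    have h : (ball (xc n) (ρc n) ∩ K).Nonempty := (Finset.mem_filter.1 hn).2
    simp only [hz, dif_pos h]
    exact h.some_mem
  have hzK : ∀ n ∈ S', z n ∈ K := fun n hn => (hzmem n hn).2
  have hz1 : ∀ n ∈ S', z n ∈ closedBall (0 : V) 1 := fun n hn =>
    closedBall_subset_closedBall hρ'1.le (hKρ' (hzK n hn))
  have hρc0 : ∀ n ∈ S', 0 < ρc n := fun n hn => (hρc n (hS'S hn)).1
  have hρcs : ∀ n ∈ S', ρc n ≤ s₀ := fun n hn => (hρc n (hS'S hn)).2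
  have h2ρc1 : ∀ n ∈ S', 2 * ρc n ≤ 1 := fun n hn => by
    have := hρcs n hn; rw [hs₀] at this; linarith
  -- the open set
  set U : Set V := ⋃ n ∈ S', ball (z n) (2 * ρc n) with hU
  have hUo : IsOpen U := isOpen_biUnion fun _ _ => isOpen_ball
  have hKU : K ⊆ U := by
    intro k hk
    obtain ⟨n, hn, hkn⟩ : ∃ n ∈ S, k ∈ ball (xc n) (ρc n) := by
      simpa only [mem_iUnion, exists_prop] using hKcov hk
    have hnS' : n ∈ S' := Finset.mem_filter.2 ⟨hn, ⟨k, hkn, hk⟩⟩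
    refine mem_iUnion₂.2 ⟨n, hnS', ?_⟩
    rw [mem_ball]
    calc dist k (z n) ≤ dist k (xc n) + dist (xc n) (z n) := dist_triangle _ _ _
      _ < ρc n + ρc n := add_lt_add (mem_ball.1 hkn) (by
          rw [dist_comm]; exact mem_ball.1 (hzmem n hnS').1)
      _ = 2 * ρc n := by ring
  set ρ₀ : ℝ := ρ' + 2 * s₀ with hρ₀
  have hρ₀1 : ρ₀ < 1 := by rw [hρ₀, hs₀]; linarith
  have hUρ₀ : U ⊆ closedBall (0 : V) ρ₀ := by
    intro y hy
    obtain ⟨n, hn, hyn⟩ : ∃ n ∈ S', y ∈ ball (z n) (2 * ρc n) := by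
      simpa only [exists_prop] using mem_iUnion₂.1 hy
    rw [mem_closedBall_zero_iff]
    have h1 : ‖y‖ ≤ ‖z n‖ + dist y (z n) := by
      have := norm_le_norm_add_norm_sub' y (z n)
      rwa [← dist_eq_norm] at this
    have h2 : ‖z n‖ ≤ ρ' := mem_closedBall_zero_iff.1 (hKρ' (hzK n hn))
    have h3 := hρcs n hn
    linarith [mem_ball.1 hyn]
  have hUm : MeasurableSet U := hUo.measurableSet
  -- the total content of the cover
  have hcontent : ∑ n ∈ S', ENNReal.ofReal ((2 * ρc n) ^ (2 * (q + 1))) ≤ B₀ * γ' := by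
    have h1 : ∀ n ∈ S', ENNReal.ofReal ((2 * ρc n) ^ (2 * (q + 1))) =
        2 ^ (2 * (q + 1)) * ENNReal.ofReal (ρc n) ^ d := by
      intro n hn
      rw [hd, ofReal_rpow_natCast_eq (hρc0 n hn).le, mul_pow, ENNReal.ofReal_mul (by positivity),
        ENNReal.ofReal_pow (by norm_num), ENNReal.ofReal_ofNat]
    rw [Finset.sum_congr rfl h1, ← Finset.mul_sum]
    have h2 : ∑ n ∈ S', ENNReal.ofReal (ρc n) ^ d ≤ 2 ^ (d + 1) * (2 * γ') :=
      (Finset.sum_le_sum_of_subset hS'S).trans hsum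
    have h3 : (2 : ℝ≥0∞) ^ (d + 1) = 2 ^ (2 * (q + 1) + 1) := by
      rw [hd, show ((2 * (q + 1) : ℕ) : ℝ) + 1 = ((2 * (q + 1) + 1 : ℕ) : ℝ) by push_cast; ring,
        ENNReal.rpow_natCast]
    rw [h3] at h2
    calc (2 : ℝ≥0∞) ^ (2 * (q + 1)) * ∑ n ∈ S', ENNReal.ofReal (ρc n) ^ d
        ≤ 2 ^ (2 * (q + 1)) * (2 ^ (2 * (q + 1) + 1) * (2 * γ')) := by gcongr
      _ = B₀ * γ' := by rw [hB₀]; ring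
  -- small radii: `0 < r ≤ R₁ / 2`
  refine ⟨U, hUo, hKU, ?_, ?_⟩
  · filter_upwards [Ioo_mem_nhdsGT (half_pos hR₁0)] with r hr ψ hψ M hM hψM
    have hballr : ball b r ⊆ (Ω : Set V) :=
      (ball_subset_ball (by linarith [hr.2])).trans hball3
    rw [T.blowUp_apply_eq_blowUpPiece hr.1 hballr hUm hρ₀1 hUρ₀ ψ hψ]
    have hdata := T.isRectifiableData_blowUpPiece hr.1 hballr hUm hρ₀1 hUρ₀
    -- mass of the piece over `U`
    have hmass : (T.blowUpPiece b r U).mass ≤ Cd * (B₀ * γ') := by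
      refine (show (T.blowUpPiece b r U).mass ≤ ∫⁻ x in T.blowUpSet b r ∩ U,
        ‖(T.blowUpDensity b r x : ℝ)‖ₑ ∂(μHE[2 * (q + 1)] : Measure V) from hdata.mass_le).trans ?_
      rw [hU, inter_iUnion₂]
      refine (lintegral_biUnion_finset_le _ S' _ _).trans ?_
      calc ∑ n ∈ S', ∫⁻ x in T.blowUpSet b r ∩ ball (z n) (2 * ρc n),
            ‖(T.blowUpDensity b r x : ℝ)‖ₑ ∂(μHE[2 * (q + 1)] : Measure V)
          ≤ ∑ n ∈ S', Cd * ENNReal.ofReal ((2 * ρc n) ^ (2 * (q + 1))) :=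
            Finset.sum_le_sum fun n hn => hCd r hr.1 hr.2.le (z n) (hz1 n hn) (2 * ρc n)
              (by linarith [hρc0 n hn]) (h2ρc1 n hn)
        _ = Cd * ∑ n ∈ S', ENNReal.ofReal ((2 * ρc n) ^ (2 * (q + 1))) := by
            rw [Finset.mul_sum]
        _ ≤ Cd * (B₀ * γ') := by gcongr
    have hmasstop : (T.blowUpPiece b r U).mass ≠ ⊤ :=
      ne_top_of_le_ne_top (ENNReal.mul_ne_top hCdtop (ENNReal.mul_ne_top hB₀top hγ'top)) hmass
    have hψM' : ∀ x, ‖(TestFunction.monoCLM ℝ ψ : TestForm (⊤ : Opens V) (2 * (q + 1))) x‖ ≤ M :=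
      fun x => by
        rw [TestForm.monoCLM_apply_of_le (show unitBall V ≤ (⊤ : Opens V) from le_top)]
        exact hψM x
    calc |T.blowUpPiece b r U (TestFunction.monoCLM ℝ ψ)|
        ≤ M * (T.blowUpPiece b r U).mass.toReal :=
          Current.abs_apply_le_mul_toReal_mass _ hmasstop hM hψM'
      _ ≤ M * (Cd * (B₀ * γ')).toReal :=
          mul_le_mul_of_nonneg_left (ENNReal.toReal_mono
            (ENNReal.mul_ne_top hCdtop (ENNReal.mul_ne_top hB₀top hγ'top)) hmass) hM.le
      _ ≤ M * γ :=
          mul_le_mul_of_nonneg_left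
            (hkey Cd hCdtop (by rw [hKr]; linarith [ENNReal.toReal_nonneg (a := Cc)])) hM.le
      _ = γ * M := mul_comm _ _
  · intro ψ hψ M hM hψM
    have hdataC := Harvey1977_isRectifiableData_toCurrent_holds V (⊤ : Opens V) (q + 1) C
    have hrepr := hdataC.isRepresentable
    have happly : C.toCurrent ψ =
        (currentOfIntegration (C.carrier ∩ U) C.density C.orientationFrame :
          Current (⊤ : Opens V) (2 * (q + 1))) ψ := by
      rw [toCurrent_def, ← hdataC.restrictSet_eq hUm,
        hrepr.restrictSet_apply_of_support_subset hUm ((subset_tsupport _).trans hψ)]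
    rw [happly]
    have hdataU := hdataC.inter hUm
    have hmass : (currentOfIntegration (C.carrier ∩ U) C.density C.orientationFrame :
        Current (⊤ : Opens V) (2 * (q + 1))).mass ≤ Cc * (B₀ * γ') := by
      refine hdataU.mass_le.trans ?_
      rw [hU, inter_iUnion₂]
      refine (lintegral_biUnion_finset_le _ S' _ _).trans ?_
      calc ∑ n ∈ S', ∫⁻ x in C.carrier ∩ ball (z n) (2 * ρc n),
            ‖(C.density x : ℝ)‖ₑ ∂(μHE[2 * (q + 1)] : Measure V)
          ≤ ∑ n ∈ S', Cc * ENNReal.ofReal ((2 * ρc n) ^ (2 * (q + 1))) :=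
            Finset.sum_le_sum fun n hn => hCc (z n) (hz1 n hn) (2 * ρc n)
              (by linarith [hρc0 n hn]) (h2ρc1 n hn)
        _ = Cc * ∑ n ∈ S', ENNReal.ofReal ((2 * ρc n) ^ (2 * (q + 1))) := by
            rw [Finset.mul_sum]
        _ ≤ Cc * (B₀ * γ') := by gcongr
    have hmasstop : (currentOfIntegration (C.carrier ∩ U) C.density C.orientationFrame :
        Current (⊤ : Opens V) (2 * (q + 1))).mass ≠ ⊤ :=
      ne_top_of_le_ne_top (ENNReal.mul_ne_top hCctop (ENNReal.mul_ne_top hB₀top hγ'top)) hmass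
    calc |(currentOfIntegration (C.carrier ∩ U) C.density C.orientationFrame :
          Current (⊤ : Opens V) (2 * (q + 1))) ψ|
        ≤ M * (currentOfIntegration (C.carrier ∩ U) C.density C.orientationFrame :
            Current (⊤ : Opens V) (2 * (q + 1))).mass.toReal :=
          Current.abs_apply_le_mul_toReal_mass _ hmasstop hM hψM
      _ ≤ M * (Cc * (B₀ * γ')).toReal :=
          mul_le_mul_of_nonneg_left (ENNReal.toReal_mono
            (ENNReal.mul_ne_top hCctop (ENNReal.mul_ne_top hB₀top hγ'top)) hmass) hM.le
      _ ≤ M * γ :=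
          mul_le_mul_of_nonneg_left
            (hkey Cc hCctop (by rw [hKr]; linarith [ENNReal.toReal_nonneg (a := Cd)])) hM.le
      _ = γ * M := mul_comm _ _

/-! ### (P) Assembly: weak convergence on the whole unit ball -/

/-- **King's theorem in the weak topology** [King 1971, Thm. 5.1.6; Harvey1977, Thm. 1.31: "the
weak limit `lim_{r→0} (1/r)_*(T)` exists"; Federer1969, 4.3.18]: for a holomorphic `p`-chain `T`
(`p = q + 1`) with support of pure dimension `p` and `b ∈ Ω`, the blow-ups
`D_r = (1/r)_*(τ_{-b})_*[T]` converge weakly on the unit ball, as `r → 0⁺` (full limit), to the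
current of the tangent-cone chain: `D_r(ψ) → [C(T,b)](ψ)` for every `ψ ∈ 𝓓^{2p}(𝐁(0,1))`. Proof:
smooth partition of unity on `spt ψ` subordinate to a neighbourhood of the bad directions with
small mass (`exists_open_limitConeBad_subset`) and finitely many neighbourhoods of regular / off-cone
directions where the convergence is known (`tendsto_blowUp_apply_tangentConeChain`,
`exists_nhds_forall_blowUp_apply_eq_zero`). [cite: Harvey1977, Thm. 1.31; Federer1969, 4.3.18] -/
theorem tendsto_blowUp_apply {q : ℕ} (T : HolomorphicChain 𝓘(ℂ, V) Ω (q + 1))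
    (hA : HasPureDim 𝓘(ℂ, V) T.support (q + 1)) {b : V} (hb : b ∈ (Ω : Set V))
    (ψ : TestForm (unitBall V) (2 * (q + 1))) :
    Tendsto (fun r => T.blowUp b r ψ) (𝓝[>] (0 : ℝ))
      (𝓝 ((tangentConeChain T hA hb).toCurrent (TestFunction.monoCLM ℝ ψ))) := by
  classical
  letI : InnerProductSpace ℝ V := InnerProductSpace.complexToReal
  haveI : FiniteDimensional ℝ V := FiniteDimensional.complexToReal V
  set C := tangentConeChain T hA hb with hCdef
  have hle : unitBall V ≤ (⊤ : Opens V) := le_top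
  -- the weak-limit functional
  set L : TestForm (unitBall V) (2 * (q + 1)) → ℝ :=
    fun φ => C.toCurrent (TestFunction.monoCLM ℝ φ) with hL
  have hLsum : ∀ {ι : Type u} (s : Finset ι) (φ : ι → TestForm (unitBall V) (2 * (q + 1))),
      L (∑ i ∈ s, φ i) = ∑ i ∈ s, L (φ i) := by
    intro ι s φ
    simp only [hL, map_sum]
  have htsupp_mono : ∀ φ : TestForm (unitBall V) (2 * (q + 1)),
      tsupport ⇑(TestFunction.monoCLM ℝ φ : TestForm (⊤ : Opens V) (2 * (q + 1))) = tsupport ⇑φ :=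
    fun φ => by rw [TestForm.monoCLM_apply_of_le hle]
  -- the local convergence property of an open set
  set Q : Set V → Prop := fun W => ∀ φ : TestForm (unitBall V) (2 * (q + 1)), tsupport ⇑φ ⊆ W →
    Tendsto (fun r => T.blowUp b r φ) (𝓝[>] (0 : ℝ)) (𝓝 (L φ)) with hQ
  rw [Metric.tendsto_nhds]
  intro ε hε
  -- the support of `ψ` and its size
  set K : Set V := tsupport ⇑ψ with hK
  have hKc : IsCompact K := ψ.hasCompactSupport
  have hK1 : K ⊆ ball (0 : V) 1 := ψ.tsupport_subset
  obtain ⟨ρ', hρ'0, hρ'1, hKρ'⟩ : ∃ ρ' : ℝ, 0 ≤ ρ' ∧ ρ' < 1 ∧ K ⊆ closedBall (0 : V) ρ' := by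
    rcases K.eq_empty_or_nonempty with hKe | hne
    · exact ⟨0, le_rfl, one_pos, by rw [hKe]; exact empty_subset _⟩
    · obtain ⟨x, hxK, hmax⟩ := hKc.exists_isMaxOn hne continuous_norm.continuousOn
      exact ⟨‖x‖, norm_nonneg _, mem_ball_zero_iff.1 (hK1 hxK),
        fun y hy => mem_closedBall_zero_iff.2 (hmax hy)⟩
  obtain ⟨M₀, hM₀⟩ := ψ.hasCompactSupport.exists_bound_of_continuous ψ.contDiff.continuous
  set M : ℝ := max M₀ 1 with hM
  have hM0 : 0 < M := lt_of_lt_of_le one_pos (le_max_right _ _)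
  have hψM : ∀ x, ‖ψ x‖ ≤ M := fun x => (hM₀ x).trans (le_max_left _ _)
  -- (B) the neighbourhood of the bad directions
  set γ : ℝ := ε / (4 * M) with hγ
  have hγ0 : 0 < γ := by rw [hγ]; positivity
  have hγM : γ * M = ε / 4 := by rw [hγ]; field_simp
  obtain ⟨U₀, hU₀o, hBadU₀, hD₀, hC₀⟩ := T.exists_open_limitConeBad_subset hA hb hρ'0 hρ'1 hγ0
  -- (Z)/(M) good neighbourhoods of the remaining points of `K`
  have hgood : ∀ x ∈ K \ U₀, ∃ W : Set V, IsOpen W ∧ x ∈ W ∧ Q W := by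
    rintro x ⟨hxK, hxU₀⟩
    have hx1 : ‖x‖ < 1 := mem_ball_zero_iff.1 (hK1 hxK)
    by_cases hxF : x ∈ limitCone T.support hb
    · -- a regular direction
      have hxt : (⟨x, trivial⟩ : (⊤ : Opens V)) ∈ limitConeTop T.support hb := hxF
      have hxreg : (⟨x, trivial⟩ : (⊤ : Opens V)) ∈ limitConeReg T.support hb (q + 1) := by
        by_contra h
        exact hxU₀ (hBadU₀ ⟨⟨⟨x, trivial⟩, ⟨hxt, h⟩, rfl⟩, hKρ' hxK⟩)
      obtain ⟨W, hWo, hxW, hW⟩ := T.tendsto_blowUp_apply_tangentConeChain hA hb hxreg hx1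
      exact ⟨W, hWo, hxW, hW⟩
    · -- a direction off the cone
      obtain ⟨W, hWo, hxW, -, hWF, hW⟩ := T.exists_nhds_forall_blowUp_apply_eq_zero hb hxF hx1
      refine ⟨W, hWo, hxW, fun φ hφ => ?_⟩
      have hL0 : L φ = 0 :=
        T.toCurrent_tangentConeChain_apply_eq_zero hA hb hWF _ ((htsupp_mono φ).symm ▸ hφ)
      rw [hL0]
      exact tendsto_const_nhds.congr' (hW.mono fun r hr => (hr φ hφ).symm)
  choose W hWo hxW hWQ using hgood
  -- a finite subcover of the compact set `K ∖ U₀`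
  have hK₁c : IsCompact (K \ U₀) := hKc.diff hU₀o
  obtain ⟨t, ht⟩ := hK₁c.elim_finite_subcover (fun x : ↥(K \ U₀) => W x x.2)
    (fun x => hWo x x.2) fun x hx => mem_iUnion.2 ⟨⟨x, hx⟩, hxW x hx⟩
  -- the open cover of `K` indexed by `Option t`
  set Uf : Option ↥t → Set V := fun i => match i with
    | none => U₀
    | some j => W (j : ↥(K \ U₀)) (j : ↥(K \ U₀)).2 with hUf
  have hUfo : ∀ i, IsOpen (Uf i) := by
    rintro (_ | j)
    · exact hU₀o
    · exact hWo _ _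
  have hcov : K ⊆ ⋃ i, Uf i := by
    intro x hxK
    by_cases hx0 : x ∈ U₀
    · exact mem_iUnion.2 ⟨none, hx0⟩
    · obtain ⟨j, hj, hxj⟩ : ∃ j ∈ t, x ∈ W (j : V) j.2 := by
        simpa only [exists_prop] using mem_iUnion₂.1 (ht ⟨hxK, hx0⟩)
      exact mem_iUnion.2 ⟨some ⟨j, hj⟩, hxj⟩
  -- a smooth partition of unity on `K` subordinate to the cover
  obtain ⟨f, hf⟩ := SmoothPartitionOfUnity.exists_isSubordinate 𝓘(ℝ, V) (isClosed_tsupport ⇑ψ)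
    Uf hUfo hcov
  have hfs : ∀ i, ContDiff ℝ ∞ ⇑(f i) := fun i => contMDiff_iff_contDiff.1 (f i).contMDiff
  set piece : Option ↥t → TestForm (unitBall V) (2 * (q + 1)) :=
    fun i => TestForm.smulFun (hfs i) ψ with hpiece
  have hpiece_apply : ∀ i x, piece i x = f i x • ψ x := fun i x => rfl
  have hpiece_tsupp : ∀ i, tsupport ⇑(piece i) ⊆ Uf i := fun i => by
    refine Subset.trans ?_ (hf i)
    have : (⇑(piece i) : V → Covector V (2 * (q + 1))) = fun x => f i x • ψ x := rfl
    rw [this]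
    exact tsupport_smul_subset_left _ _
  have hpiece_norm : ∀ i x, ‖piece i x‖ ≤ M := fun i x => by
    rw [hpiece_apply, norm_smul, Real.norm_of_nonneg (f.nonneg i x)]
    calc f i x * ‖ψ x‖ ≤ 1 * ‖ψ x‖ :=
          mul_le_mul_of_nonneg_right (f.le_one i x) (norm_nonneg _)
      _ ≤ M := by rw [one_mul]; exact hψM x
  -- `ψ = Σ_i (f i) ψ`
  have hsumψ : ∑ i, piece i = ψ := by
    apply TestFunction.ext
    intro x
    rw [testForm_sum_apply]
    simp only [hpiece_apply]
    rw [← Finset.sum_smul]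
    by_cases hx : x ∈ K
    · have h1 : ∑ i, f i x = 1 := by
        have := f.sum_eq_one hx
        rwa [finsum_eq_sum_of_fintype] at this
      rw [h1, one_smul]
    · have h0 : ψ x = 0 := by
        by_contra h
        exact hx (subset_tsupport _ h)
      rw [h0, smul_zero]
  -- splitting `D_r ψ` and `L ψ` into the bad piece and the good pieces
  have hDsplit : ∀ r, T.blowUp b r ψ =
      T.blowUp b r (piece none) + ∑ j : ↥t, T.blowUp b r (piece (some j)) := by
    intro r
    conv_lhs => rw [← hsumψ]
    rw [map_sum, Fintype.sum_option]
  have hLsplit : L ψ = L (piece none) + ∑ j : ↥t, L (piece (some j)) := by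
    conv_lhs => rw [← hsumψ]
    rw [hLsum, Fintype.sum_option]
  -- the good pieces converge
  have hgoodT : Tendsto (fun r => ∑ j : ↥t, T.blowUp b r (piece (some j))) (𝓝[>] (0 : ℝ))
      (𝓝 (∑ j : ↥t, L (piece (some j)))) :=
    tendsto_finsetSum _ fun j _ => hWQ _ (j : ↥(K \ U₀)).2 (piece (some j)) (hpiece_tsupp (some j))
  -- the bad piece is uniformly small
  have hbadL : |L (piece none)| ≤ γ * M :=
    hC₀ _ ((htsupp_mono _).symm ▸ hpiece_tsupp none) M hM0 fun x => by
      rw [TestForm.monoCLM_apply_of_le hle]; exact hpiece_norm none x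
  have hbadD : ∀ᶠ r in 𝓝[>] (0 : ℝ), |T.blowUp b r (piece none)| ≤ γ * M :=
    hD₀.mono fun r hr => hr (piece none) (hpiece_tsupp none) M hM0 (hpiece_norm none)
  filter_upwards [hbadD, (Metric.tendsto_nhds.1 hgoodT) (ε / 2) (half_pos hε)] with r hrD hrG
  rw [Real.dist_eq] at hrG ⊢
  rw [hDsplit r, show C.toCurrent (TestFunction.monoCLM ℝ ψ) = L ψ from rfl, hLsplit]
  have hrw : T.blowUp b r (piece none) + ∑ j : ↥t, T.blowUp b r (piece (some j)) -
      (L (piece none) + ∑ j : ↥t, L (piece (some j))) =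
      (T.blowUp b r (piece none) - L (piece none)) +
        (∑ j : ↥t, T.blowUp b r (piece (some j)) - ∑ j : ↥t, L (piece (some j))) := by ring
  rw [hrw]
  calc |T.blowUp b r (piece none) - L (piece none) +
        (∑ j : ↥t, T.blowUp b r (piece (some j)) - ∑ j : ↥t, L (piece (some j)))|
      ≤ |T.blowUp b r (piece none) - L (piece none)| +
          |∑ j : ↥t, T.blowUp b r (piece (some j)) - ∑ j : ↥t, L (piece (some j))| :=
        abs_add_le _ _
    _ ≤ (|T.blowUp b r (piece none)| + |L (piece none)|) +
          |∑ j : ↥t, T.blowUp b r (piece (some j)) - ∑ j : ↥t, L (piece (some j))| := by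
        gcongr
        exact abs_sub _ _
    _ < (γ * M + γ * M) + ε / 2 := by linarith [hrD, hbadL, hrG]
    _ = ε := by rw [hγM]; ring

/-- **The weak tangent cone of a holomorphic chain, unconditionally** [Harvey1977, Thm. 1.31;
King 1971, Thm. 5.1.6]: for every holomorphic `p`-chain `T` on `Ω` (`p = q + 1`) and `b ∈ Ω` there
is a holomorphic `p`-chain `C` on `V` whose support is a complex cone such that the blow-ups
converge weakly to `[C]` on the unit ball: `D_r(ψ) → [C](ψ)` as `r → 0⁺` for every
`ψ ∈ 𝓓^{2p}(𝐁(0,1))` (the tangent-cone chain if `|T| ≠ ∅`, which then has pure dimension `p`,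
`hasPureDim_support`; the zero chain otherwise). [cite: Harvey1977, Thm. 1.31; Federer1969, 4.3.18] -/
theorem exists_conic_tendsto_blowUp_apply {q : ℕ} (T : HolomorphicChain 𝓘(ℂ, V) Ω (q + 1))
    {b : V} (hb : b ∈ (Ω : Set V)) :
    ∃ C : HolomorphicChain 𝓘(ℂ, V) (⊤ : Opens V) (q + 1),
      (∀ x ∈ C.support, ∀ c : ℂ, (⟨c • (x : V), trivial⟩ : (⊤ : Opens V)) ∈ C.support) ∧
      ∀ ψ : TestForm (unitBall V) (2 * (q + 1)),
        Tendsto (fun r => T.blowUp b r ψ) (𝓝[>] (0 : ℝ))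
          (𝓝 (C.toCurrent (TestFunction.monoCLM ℝ ψ))) := by
  letI : InnerProductSpace ℝ V := InnerProductSpace.complexToReal
  rcases T.support.eq_empty_or_nonempty with he | hne
  · refine ⟨0, fun x hx => ?_, fun ψ => ?_⟩
    · simp at hx
    · have hcar : T.carrier = ∅ :=
        eq_empty_of_subset_empty ((carrier_subset_image_support T).trans (by rw [he, image_empty]))
      have hD : ∀ r, T.blowUp b r = 0 := fun r => by
        rw [HolomorphicChain.blowUp, show (fun y : V => b + r • y) ⁻¹' T.carrier ∩ ball (0 : V) 1 = ∅
          by rw [hcar, preimage_empty, empty_inter], currentOfIntegration_empty]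
      simp only [hD, toCurrent_zero]
      exact tendsto_const_nhds
  · have hA : HasPureDim 𝓘(ℂ, V) T.support (q + 1) := T.hasPureDim_support hne
    exact ⟨tangentConeChain T hA hb, fun x hx c => T.tangentConeChain_smul_mem_support hA hb hx c,
      fun ψ => T.tendsto_blowUp_apply hA hb ψ⟩

end HolomorphicChain

end Literature.Geometry.Kaehler
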